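import Literature.AlgebraicGeometry.HodgeTheory.ZariskiClosureCosets
import Literature.NumberTheory.Automorphic.ZariskiGL
import HarnessLib

/-!
# Bridge: the basis-free `K`-points closure `glZariskiClosure Δ` / identity component
# `glIdentityComponent Δ` of `Δ ≤ GL(V)` ARE the Zariski closure / identity component of the matrix group
# `[Δ]_b ≤ GL_n(K)` in the algebraic-group vocabulary of `Literature/NumberTheory/Automorphic`
# (Springer 2.2.1, 2.2.4; Borel I.1.7, I.2.1) — on `K`-points, any field

Family `hodge`, layer `Literature/AlgebraicGeometry/HodgeTheory`. THEOREMS only (no definition, no named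
fact). Two vocabularies for the same objects live in the tree:

* `AlgebraicMonodromyMumfordTate` (this layer): for `Δ ≤ GL(V) = V ≃ₗ[K] V`, `glZariskiClosure Δ` = the
  automorphisms at which every polynomial IN THE MATRIX ENTRIES (any basis) vanishing on `Δ` vanishes, and
  `glIdentityComponent Δ = ⋂ {(Δ')^Zar : Δ' ≤ Δ of finite index}`; its docstring leaves "the identification of
  `glIdentityComponent` with the identity component in the matrix vocabulary
  `NumberTheory.Automorphic.IsZConnected/zariskiClosure` (a basis must be chosen)" to a user who needs
  Springer's structure theory;
* `NumberTheory/Automorphic/{LinearAlgebraicGroups, IdentityComponent, ZariskiGL}`: subgroups of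
  `GL n k`, the Zariski topology `zariskiTopologyGL` (zero loci of polynomials in the entries AND `det⁻¹`),
  `zariskiClosure A` (topological closure, a subgroup), `identityComponent H` (meet of the algebraic
  finite-index subgroups), with the structure theory (`IsZConnected`, dimension, Lie algebras, images,
  Borel subgroups, …) built on top.

This file is that identification, for any basis `b : ι → V` and any group isomorphism
`Ψ : GL(V) ≃* GL ι K` reading off matrices in `b` (`(Ψ g) = [g]_b`; one exists, `exists_mulEquiv_coe_eq_toMatrix`):

* `mem_glZariskiClosure_iff_mem_zariskiClosure` — **`g ∈ Δ^Zar ⟺ [g]_b ∈ zariskiClosure [Δ]_b`**: a relation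
  `Q(x, 1/det x) = 0` on `[Δ]_b` persists on the entry-closure by clearing denominators
  (`GlZariskiClosureGroup.evalAtInvDet_eq_zero_of_mem`, Borel I.1.7: `GL_n = D(det)`), and conversely
  entry-polynomials are particular coordinates; `map_glZariskiClosureSubgroup_eq_zariskiClosure` (as subgroups).
* `mem_glIdentityComponent_iff_mem_identityComponent` — **`g ∈ (Δ^Zar)° ⟺ [g]_b ∈ identityComponent
  (zariskiClosure [Δ]_b)`**: (⇐) the closure of a finite-index `Δ' ≤ Δ` is algebraic of finite index in the
  closure of `Δ` (`ZariskiClosureCosets.finiteIndex_glZariskiClosureSubgroup`), hence contains the identity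
  component (Springer 2.2.1 (iii), `identityComponent_le_of_finiteIndex`); (⇒) `Δ₀ = Δ ∩ Ψ⁻¹(H°)` has finite
  index in `Δ` (`H°` has finite index in `H = zariskiClosure [Δ]_b ⊇ [Δ]_b`, Springer 2.2.1 (i)) and its closure
  lies in the algebraic subgroup `H°`.

So every theorem of the `Automorphic` structure theory about `zariskiClosure` / `identityComponent` /
`IsZConnected` becomes available for the monodromy closures `Γ^Zar`, `Mon = (Γ^Zar)°` of Hodge theory (CMSP
Lemma–Definition 15.3.7), e.g. for the Goursat core of `GoursatKolchinRibetKernels` (crux K1 of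
`Summits/HodgeConjecture/HodgeConjecture/Theses/CyclicUnitaryPowers.lean`). Written by the prover seat
`hodge-nonav-prover-Ax` (cell `hodge-nonav`).

## References
* [SpringerLAG1998] T. A. Springer, *Linear Algebraic Groups*, 2nd ed. (1998), 2.1.4 (`GL_n` affine with
  coordinates `x_{ij}, det⁻¹`), 2.2.1 (identity component), 2.2.4 (closure of a subgroup).
* [Borel1991] A. Borel, *Linear Algebraic Groups*, 2nd ed., GTM 126 (1991), I.1.7 (`GL_n = D(det)`,
  `K[GL_n] = K[x_{ij}, 1/det]`), I.2.1.
* [CarlsonMullerStachPeters2017] J. Carlson, S. Müller-Stach, C. Peters, *Period Mappings and Period Domains*,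
  2nd ed., Lemma–Definition 15.3.7 (`Γ^Zar`, `Mon = (Γ^Zar)°`).
-/

noncomputable section

open Module Literature.AlgebraicGeometry.Motives
open scoped MatrixGroups

namespace Literature.AlgebraicGeometry.HodgeTheory

universe u v w

variable {K : Type u} [Field K] {V : Type v} [AddCommGroup V] [Module K V]
variable {ι : Type w} [Fintype ι] [DecidableEq ι]

/-! ### §1 The matrix isomorphism of a basis -/

/-- **A basis identifies `GL(V)` with `GL_n(K)` compatibly with matrices**: there is a group isomorphism
`Ψ : (V ≃ₗ[K] V) ≃* GL ι K` with `Ψ g = [g]_b` (Mathlib's `generalLinearEquiv` and `toMatrixAlgEquiv` on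
units). [cite: SpringerLAG1998, 2.1.4] -/
theorem exists_mulEquiv_coe_eq_toMatrix (b : Module.Basis ι K V) :
    ∃ Ψ : (V ≃ₗ[K] V) ≃* GL ι K,
      ∀ g : V ≃ₗ[K] V, ((Ψ g : GL ι K) : Matrix ι ι K) = LinearMap.toMatrix b b (g : V →ₗ[K] V) :=
  ⟨(LinearMap.GeneralLinearGroup.generalLinearEquiv K V).symm.trans
    (Units.mapEquiv (LinearMap.toMatrixAlgEquiv b).toMulEquiv), fun _ => rfl⟩

section Bridge

variable (b : Module.Basis ι K V) (Ψ : (V ≃ₗ[K] V) ≃* GL ι K)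
  (hΨ : ∀ g : V ≃ₗ[K] V, ((Ψ g : GL ι K) : Matrix ι ι K) = LinearMap.toMatrix b b (g : V →ₗ[K] V))

omit [DecidableEq ι] in
/-- The matrix of an automorphism has non-zero determinant. [cite: Borel1991, I.1.7] -/
private theorem det_toMatrix_ne_zero (g : V ≃ₗ[K] V) [DecidableEq ι] :
    (LinearMap.toMatrix b b (g : V →ₗ[K] V)).det ≠ 0 := by
  rw [LinearMap.det_toMatrix, ← LinearEquiv.coe_det]
  exact (LinearEquiv.det g).ne_zero

include hΨ in
/-- The entry coordinates of `Ψ g` are the matrix entries `[g]_b`. [cite: SpringerLAG1998, 2.1.4] -/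
private theorem glCoordFun_comp_inl (g : V ≃ₗ[K] V) :
    (Literature.NumberTheory.Automorphic.glCoordFun (Ψ g) ∘ Sum.inl : ι × ι → K) =
      fun ij => LinearMap.toMatrix b b (g : V →ₗ[K] V) ij.1 ij.2 := by
  funext ij
  rw [Function.comp_apply, Literature.NumberTheory.Automorphic.glCoordFun_inl, hΨ]

include hΨ in
/-- **Coordinates `x_{ij}, det⁻¹` versus `K[x_{ij}][y]` at `y = 1/det`**: for every polynomial `p` in the
affine coordinates of `GL_n` there is `Q ∈ K[x_{ij}][y]` with `Q([x]_b, 1/det [x]_b) = p(Ψ x)` for all `x`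
(substitute `x_{ij} ↦ x_{ij}`, `det⁻¹ ↦ y`). [cite: Borel1991, I.1.7] -/
private theorem exists_evalAtInvDet_eq_eval
    (p : MvPolynomial (Literature.NumberTheory.Automorphic.GLCoord ι) K) :
    ∃ Q : Polynomial (MvPolynomial (ι × ι) K), ∀ x : V ≃ₗ[K] V,
      evalAtInvDet (LinearMap.toMatrix b b (x : V →ₗ[K] V)) Q =
        MvPolynomial.eval (Literature.NumberTheory.Automorphic.glCoordFun (Ψ x)) p := by
  let θ : MvPolynomial (Literature.NumberTheory.Automorphic.GLCoord ι) K →+* Polynomial (MvPolynomial (ι × ι) K) :=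
    MvPolynomial.eval₂Hom (Polynomial.C.comp MvPolynomial.C)
      (Sum.elim (fun ij : ι × ι => Polynomial.C (MvPolynomial.X ij)) fun _ => Polynomial.X)
  refine ⟨θ p, fun x => ?_⟩
  have hcomp : (evalAtInvDet (LinearMap.toMatrix b b (x : V →ₗ[K] V))).comp θ =
      MvPolynomial.eval (Literature.NumberTheory.Automorphic.glCoordFun (Ψ x)) := by
    refine MvPolynomial.ringHom_ext (fun r => ?_) (fun c => ?_)
    · rw [RingHom.comp_apply, MvPolynomial.eval_C]
      change evalAtInvDet _ (MvPolynomial.eval₂ _ _ (MvPolynomial.C r)) = r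
      rw [MvPolynomial.eval₂_C, RingHom.comp_apply, evalAtInvDet_C, MvPolynomial.eval_C]
    · rw [RingHom.comp_apply, MvPolynomial.eval_X]
      change evalAtInvDet _ (MvPolynomial.eval₂ _ _ (MvPolynomial.X c)) = _
      rw [MvPolynomial.eval₂_X]
      rcases c with ij | u
      · rw [Sum.elim_inl, evalAtInvDet_C, MvPolynomial.eval_X,
          Literature.NumberTheory.Automorphic.glCoordFun_inl, hΨ]
      · rw [Sum.elim_inr, evalAtInvDet_X, Literature.NumberTheory.Automorphic.glCoordFun_inr, hΨ]
  rw [← hcomp, RingHom.comp_apply]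

variable [Module.Finite K V]

include hΨ in
/-- **`Δ^Zar` on `K`-points, basis-free versus matrices** (Borel I.1.7 + I.2.1; Springer 2.2.4): for
`Δ ≤ GL(V)` and `g ∈ GL(V)`, `g ∈ glZariskiClosure Δ` (every entry-polynomial vanishing on `Δ` vanishes at `g`)
iff the matrix `Ψ g = [g]_b` lies in the Zariski closure `zariskiClosure (Ψ Δ)` of `Literature/NumberTheory/Automorphic`
(topological closure for the topology of zero loci of polynomials in `x_{ij}, det⁻¹`). (⇒) clear denominators:
a relation `Q(x, 1/det x) = 0` on `Ψ Δ` persists at `[g]_b` (`evalAtInvDet_eq_zero_of_mem`); (⇐) an entry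
polynomial is the coordinate polynomial `P(x_{ij})`, whose zero locus is closed.
[cite: Borel1991, I.1.7 and I.2.1] [cite: SpringerLAG1998, 2.2.4 (i)] -/
theorem mem_glZariskiClosure_iff_mem_zariskiClosure (Δ : Subgroup (V ≃ₗ[K] V)) (g : V ≃ₗ[K] V) :
    g ∈ glZariskiClosure Δ ↔
      Ψ g ∈ Literature.NumberTheory.Automorphic.zariskiClosure (Δ.map Ψ.toMonoidHom) := by
  classical
  letI := Literature.NumberTheory.Automorphic.zariskiTopologyGL ι K
  set S : Set (GL ι K) := ((Δ.map Ψ.toMonoidHom : Subgroup (GL ι K)) : Set (GL ι K)) with hS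
  have hSmem : ∀ δ ∈ Δ, Ψ δ ∈ S := fun δ hδ => ⟨δ, hδ, rfl⟩
  constructor
  · intro hg
    rw [Literature.NumberTheory.Automorphic.mem_zariskiClosure_iff]
    -- the closure is a zero locus `Z(T)`; show `Ψ g ∈ Z(T)`
    obtain ⟨T, hT⟩ := Literature.NumberTheory.Automorphic.isClosed_zariski_iff.1 (isClosed_closure (s := S))
    rw [← hS, hT]
    intro p hp
    obtain ⟨Q, hQ⟩ := exists_evalAtInvDet_eq_eval b Ψ hΨ p
    rw [← hQ]
    rw [mem_glZariskiClosure_iff, ← zariskiClosureEnd_basis_indep b] at hg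
    refine evalAtInvDet_eq_zero_of_mem b hg (det_toMatrix_ne_zero b g) ?_ Q ?_
    · rintro _ ⟨δ, _, rfl⟩
      exact det_toMatrix_ne_zero b δ
    · rintro _ ⟨δ, hδ, rfl⟩
      rw [hQ]
      have hδT : Ψ δ ∈ Literature.NumberTheory.Automorphic.zeroLocusGL T := by
        rw [← hT]
        exact subset_closure (hSmem δ hδ)
      exact hδT p hp
  · intro hg
    rw [Literature.NumberTheory.Automorphic.mem_zariskiClosure_iff, ← hS] at hg
    rw [mem_glZariskiClosure_iff, ← zariskiClosureEnd_basis_indep b]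
    intro P hP
    -- the entry polynomial `P` as a coordinate polynomial
    let p : MvPolynomial (Literature.NumberTheory.Automorphic.GLCoord ι) K := MvPolynomial.rename Sum.inl P
    have hev : ∀ x : V ≃ₗ[K] V, MvPolynomial.eval (Literature.NumberTheory.Automorphic.glCoordFun (Ψ x)) p =
        MvPolynomial.eval (fun ij : ι × ι => LinearMap.toMatrix b b (x : V →ₗ[K] V) ij.1 ij.2) P := by
      intro x
      rw [MvPolynomial.eval_rename, glCoordFun_comp_inl b Ψ hΨ]
    have hZ : S ⊆ Literature.NumberTheory.Automorphic.zeroLocusGL {p} := by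
      rintro _ ⟨δ, hδ, rfl⟩ q hq
      rw [Set.mem_singleton_iff] at hq
      subst hq
      change MvPolynomial.eval (Literature.NumberTheory.Automorphic.glCoordFun (Ψ δ)) p = 0
      rw [hev]
      exact hP _ ⟨δ, hδ, rfl⟩
    have hgZ := closure_minimal hZ (Literature.NumberTheory.Automorphic.isClosed_zeroLocusGL _) hg
    have := hgZ p rfl
    rwa [hev] at this

include hΨ in
/-- The same as an equality of subgroups of `GL ι K`: `Ψ(Δ^Zar) = zariskiClosure (Ψ Δ)`.
[cite: SpringerLAG1998, 2.2.4 (i)] -/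
theorem map_glZariskiClosureSubgroup_eq_zariskiClosure (Δ : Subgroup (V ≃ₗ[K] V)) :
    (glZariskiClosureSubgroup Δ).map Ψ.toMonoidHom =
      Literature.NumberTheory.Automorphic.zariskiClosure (Δ.map Ψ.toMonoidHom) := by
  ext x
  rw [Subgroup.mem_map_equiv, mem_glZariskiClosureSubgroup_iff,
    mem_glZariskiClosure_iff_mem_zariskiClosure b Ψ hΨ, MulEquiv.apply_symm_apply]

include hΨ in
/-- **`(Δ^Zar)°` on `K`-points, basis-free versus matrices** (Springer 2.2.1): for `Δ ≤ GL(V)` and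
`g ∈ GL(V)`, `g ∈ glIdentityComponent Δ = ⋂_{Δ' f.i.} (Δ')^Zar` iff the matrix `Ψ g = [g]_b` lies in the
identity component `identityComponent (zariskiClosure (Ψ Δ))` of `Literature/NumberTheory/Automorphic` (the meet of
the algebraic finite-index subgroups of the closure). (⇐) `zariskiClosure (Ψ Δ')` is algebraic of finite index
in `zariskiClosure (Ψ Δ)` (`finiteIndex_glZariskiClosureSubgroup`), so it contains the identity component
(2.2.1 (iii)); (⇒) `Δ₀ = Δ ∩ Ψ⁻¹(H°)` has finite index in `Δ` because `H°` has finite index in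
`H = zariskiClosure (Ψ Δ) ⊇ Ψ Δ` (2.2.1 (i)), and `zariskiClosure (Ψ Δ₀) ≤ H°` as `H°` is algebraic.
[cite: SpringerLAG1998, 2.2.1] [cite: CarlsonMullerStachPeters2017, Lemma–Definition 15.3.7] -/
theorem mem_glIdentityComponent_iff_mem_identityComponent (Δ : Subgroup (V ≃ₗ[K] V)) (g : V ≃ₗ[K] V) :
    g ∈ glIdentityComponent Δ ↔
      Ψ g ∈ Literature.NumberTheory.Automorphic.identityComponent
        (Literature.NumberTheory.Automorphic.zariskiClosure (Δ.map Ψ.toMonoidHom)) := by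
  set L := Literature.NumberTheory.Automorphic.zariskiClosure (Δ.map Ψ.toMonoidHom) with hL
  have hLalg : Literature.NumberTheory.Automorphic.IsAlgebraicSubgroup L :=
    Literature.NumberTheory.Automorphic.isAlgebraicSubgroup_zariskiClosure _
  constructor
  · intro hg
    -- `Δ₀ = Ψ⁻¹(L°) ∩ Δ`, of finite index in `Δ`
    set L0 := Literature.NumberTheory.Automorphic.identityComponent L with hL0
    have hL0alg : Literature.NumberTheory.Automorphic.IsAlgebraicSubgroup L0 :=
      Literature.NumberTheory.Automorphic.isAlgebraicSubgroup_identityComponent hLalg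
    let C : Subgroup (V ≃ₗ[K] V) := L0.comap Ψ.toMonoidHom
    let Δ₀ : Subgroup (V ≃ₗ[K] V) := C ⊓ Δ
    have hΔL : Δ ≤ L.comap Ψ.toMonoidHom := fun δ hδ =>
      Literature.NumberTheory.Automorphic.le_zariskiClosure _ ⟨δ, hδ, rfl⟩
    have hfi : (Δ₀.subgroupOf Δ).FiniteIndex := by
      refine ⟨?_⟩
      change Δ₀.relIndex Δ ≠ 0
      rw [Subgroup.inf_relIndex_right]
      have h1 : (L0.comap Ψ.toMonoidHom).relIndex (L.comap Ψ.toMonoidHom) ≠ 0 :=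
        Subgroup.relIndex_comap_ne_zero _
          (Literature.NumberTheory.Automorphic.finiteIndex_identityComponent hLalg).index_ne_zero
      exact fun h0 => h1 (Subgroup.relIndex_eq_zero_of_le_right hΔL h0)
    have hg0 : g ∈ glZariskiClosure Δ₀ := (mem_glIdentityComponent_iff Δ g).1 hg Δ₀ inf_le_right hfi
    rw [mem_glZariskiClosure_iff_mem_zariskiClosure b Ψ hΨ] at hg0
    refine Literature.NumberTheory.Automorphic.zariskiClosure_le hL0alg ?_ hg0
    rintro _ ⟨δ, hδ, rfl⟩
    exact hδ.1
  · intro hg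
    rw [mem_glIdentityComponent_iff]
    intro Δ' hle hfi
    set L' := Literature.NumberTheory.Automorphic.zariskiClosure (Δ'.map Ψ.toMonoidHom) with hL'
    have hL'alg : Literature.NumberTheory.Automorphic.IsAlgebraicSubgroup L' :=
      Literature.NumberTheory.Automorphic.isAlgebraicSubgroup_zariskiClosure _
    have hL'L : L' ≤ L := Literature.NumberTheory.Automorphic.zariskiClosure_mono (Subgroup.map_mono hle)
    -- finite index, transported from `finiteIndex_glZariskiClosureSubgroup`
    have hfi' : (L'.subgroupOf L).FiniteIndex := by
      refine ⟨?_⟩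
      change L'.relIndex L ≠ 0
      rw [hL', hL, ← map_glZariskiClosureSubgroup_eq_zariskiClosure b Ψ hΨ Δ',
        ← map_glZariskiClosureSubgroup_eq_zariskiClosure b Ψ hΨ Δ,
        Subgroup.relIndex_map_map_of_injective _ _ Ψ.injective]
      exact (finiteIndex_glZariskiClosureSubgroup (Γ := Δ) (Λ := Δ') hfi).index_ne_zero
    have hle' := Literature.NumberTheory.Automorphic.identityComponent_le_of_finiteIndex hL'L hL'alg hfi'
    rw [mem_glZariskiClosure_iff_mem_zariskiClosure b Ψ hΨ]
    exact hle' hg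

include hΨ in
/-- The same as an equality of subgroups of `GL ι K`: the image of (the subgroup with carrier)
`glIdentityComponent Δ` is `identityComponent (zariskiClosure (Ψ Δ))`; stated pointwise through `Ψ.symm`.
[cite: SpringerLAG1998, 2.2.1] -/
theorem symm_mem_glIdentityComponent_iff (Δ : Subgroup (V ≃ₗ[K] V)) (x : GL ι K) :
    Ψ.symm x ∈ glIdentityComponent Δ ↔
      x ∈ Literature.NumberTheory.Automorphic.identityComponent
        (Literature.NumberTheory.Automorphic.zariskiClosure (Δ.map Ψ.toMonoidHom)) := by
  rw [mem_glIdentityComponent_iff_mem_identityComponent b Ψ hΨ, MulEquiv.apply_symm_apply]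

include hΨ in
/-- **The algebraic monodromy group is Zariski-connected in the matrix picture**: the image of
`glIdentityComponent Δ` is the identity component of the algebraic subgroup `zariskiClosure (Ψ Δ)`, hence a
Zariski-connected algebraic subgroup of finite index (Springer 2.2.1 (i)) — recorded as: `identityComponent
(zariskiClosure (Ψ Δ))` is `IsZConnected`, and its `Ψ`-preimage is exactly `glIdentityComponent Δ`.
[cite: SpringerLAG1998, 2.2.1 (i)] -/
theorem isZConnected_identityComponent_zariskiClosure_map (Δ : Subgroup (V ≃ₗ[K] V)) :
    Literature.NumberTheory.Automorphic.IsZConnected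
        (Literature.NumberTheory.Automorphic.identityComponent
          (Literature.NumberTheory.Automorphic.zariskiClosure (Δ.map Ψ.toMonoidHom))) ∧
      ∀ g : V ≃ₗ[K] V, g ∈ glIdentityComponent Δ ↔
        Ψ g ∈ Literature.NumberTheory.Automorphic.identityComponent
          (Literature.NumberTheory.Automorphic.zariskiClosure (Δ.map Ψ.toMonoidHom)) :=
  ⟨Literature.NumberTheory.Automorphic.isZConnected_identityComponent
      (Literature.NumberTheory.Automorphic.isAlgebraicSubgroup_zariskiClosure _),
    fun g => mem_glIdentityComponent_iff_mem_identityComponent b Ψ hΨ Δ g⟩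

end Bridge

end Literature.AlgebraicGeometry.HodgeTheory

end
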